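import Mathlib
import HarnessLib
import HarnessLib.Audit
import Summits.Langlands.Statement
import Literature.NumberTheory.GaloisRepresentations.LocalGaloisGroupFrobeniusProofs
import Literature.NumberTheory.GaloisRepresentations.LocalGaloisGroupProofs
import Literature.NumberTheory.Automorphic.LocalConstantsProofs
import Literature.NumberTheory.Automorphic.LocalLanglandsGLProofs
import HarnessLib.Audit.Status.Attr

/-!
Route: OccultE6Transport

DORMANT since 2026-08-22T10:31:38Z (reconciler: no traction for 5.3 d (last activity item-evidence-added at 2026-08-17T03:13:47Z); parked, not closed — `ledger route dormant route-Langlands-OccultE6Transport --off` to reactivate) — unstaffed, not closed; items shared with open routes are served there. `ledger route dormant <id> --off` reactivates.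

# Route OccultE6Transport — 27 lines ⇒ modular abelian surfaces ⇒ residual automorphy of the occult
U(4,1)-motives of cubic surfaces, then μ-ordinary irregular lifting over ℚ(ω)

Route OccultE6Transport (card Langlands/Langlands/cubic-surface-e6-transport; conforming re-open of
the retired instance route
CubicSurfaceE6Transport under D-0027 §2.1). K = ℚ(ω) = CyclotomicField 3 ℚ. Thesis X (it suffices to
show; decl `OccultTypeAutomorphy`, the
Target, Lean line below): every rank-5 weakly compatible system 𝓢 over K (tree `CompatibleSystem K E
5`, arithmetic Frobenius polynomials)
which at a place λ ∣ 3 of its coefficient field is (i) absolutely irreducible, (ii) of OCCULT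
RESIDUAL TYPE — it reduces a.e. to ρ̄|Γ_K for a
ρ̄ : Γ_ℚ → SO₅(𝔽₃) ≅ W(E₆) that is surjective, has spinor parity equal to the mod-3 cyclotomic
character, tr ρ̄(c) = 1, is unramified at 2
with Frob₂-polynomial ≠ (X−1)³(X²+1), has inertia at 3 acting through {1,t}, t an involution of
trace 1, and LIFTS to GSp₄(𝔽₃) through
the exceptional isomorphism PGSp₄(𝔽₃) ≅ SO₅(𝔽₃) (a continuous GSp₄(𝔽₃)-valued ρ̃ with ρ̃⁻¹(centre) =
ker ρ̄; Tate obstruction assumed,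
not claimed: new explicit clause) — (iii) of μ-ORDINARY OCCULT
SHAPE at the prime over 3 (NEW in this re-open: in some frame the decomposition group is block upper
triangular of type (1,3,1), and on an
open subgroup of inertia the rank-1 sub acts through ε^a, the rank-1 quotient through ε^(a−1), the
middle block through scalars), and
(iv) POLARISED (charpoly at the conjugate place = q^a-reciprocal dual), is AUTOMORPHIC: for every
embedding E → ℂ and every hcpt there is
an L-algebraic cuspidal π on GL₅(𝔸_K) whose Satake parameters match 𝓢.charpoly at almost all places.
X is reached through the cruxes
E6ResidualTransport (rank 2: the transport = residual automorphy of every ρ̄ of that E₆ local type,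
from modularity of abelian surfaces)
and PolarisedLiftingRank5 (rank 3: μ-ordinary irregular-weight lifting in rank 5 over K), glued by
pure logic (Assembly, proved in
Sketch.lean); E6TypeRealised (rank 4) certifies the hypothesis class is inhabited. X is a family of
instances of direction (B) of the
summit for n = 5 over K in IRREGULAR Hodge–Tate type {0,1,1,1,1}/{0,0,0,0,1}; the intended members
are the occult λ-adic realisations
H³(T_S)_ω of smooth cubic surfaces S/ℚ (T_S → ℙ³ the cyclic cubic threefold;
AllcockCarlsonToledo2002, Achter2020). The remainder of the
summit is the support item SectorComplement (never staffed); the deciding theorem is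
`closes : E6ResidualTransport → PolarisedLiftingRank5 → SectorComplement → Langlands`.
Lean: `open Literature.NumberTheory.GaloisRepresentations Literature.NumberTheory.Automorphic
Polynomial NumberField IsDedekindDomain Field in ∀ (E : Type) [Field E] [NumberField E] (𝓢 :
CompatibleSystem (CyclotomicField 3 ℚ) E 5), (∃ («λ» : HeightOneSpectrum (𝓞 E)) (j : ZMod 3 →+* 𝓞 E
⧸ «λ».asIdeal) (ρ : FramedGaloisRep ℚ (ZMod 3) 5), (∀ σ, (ρ σ).valᵀ * (ρ σ).val = 1 ∧ (ρ σ).val.det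
= 1) ∧ (∀ g : Matrix (Fin 5) (Fin 5) (ZMod 3), gᵀ * g = 1 → g.det = 1 → ∃ σ, (ρ σ).val = g) ∧ (∀ (σ
: absoluteGaloisGroup ℚ) (ζ : AlgebraicClosure ℚ), ζ ^ 2 + ζ + 1 = 0 → (σ • ζ = ζ ↔ ρ σ ∈
Subgroup.closure ((fun x : GL (Fin 5) (ZMod 3) ↦ x * x) '' {x : GL (Fin 5) (ZMod 3) | x.valᵀ * x.val
= 1}))) ∧ (∀ (φ : ℚ →+* ℝ) (c : absoluteGaloisGroup ℚ), IsComplexConjugation φ c → (ρ c).val.trace =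
1) ∧ (∀ v : HeightOneSpectrum (𝓞 ℚ), (2 : 𝓞 ℚ) ∈ v.asIdeal → ρ.IsUnramifiedAt v ∧ ∀ P,
ρ.HasFrobCharpolyAt v P → P ≠ (X - 1) ^ 3 * (X ^ 2 + 1)) ∧ (∀ v : HeightOneSpectrum (𝓞 ℚ), (3 : 𝓞 ℚ)
∈ v.asIdeal → ∀ 𝔓 ∈ v.primesAbove, ∃ t : Matrix (Fin 5) (Fin 5) (ZMod 3), t * t = 1 ∧ t.trace = 1 ∧
(∀ σ ∈ 𝔓.inertia (absoluteGaloisGroup ℚ), (ρ σ).val = 1 ∨ (ρ σ).val = t) ∧ (∃ σ ∈ 𝔓.inertia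
(absoluteGaloisGroup ℚ), (ρ σ).val = t)) ∧ (∃ ρt : FramedGaloisRep ℚ (ZMod 3) 4, (∀ σ, (∃ ν : ZMod
3, ν ≠ 0 ∧ (ρt σ).valᵀ * !![0, 0, 1, 0; 0, 0, 0, 1; -1, 0, 0, 0; 0, -1, 0, 0] * (ρt σ).val = ν •
!![0, 0, 1, 0; 0, 0, 0, 1; -1, 0, 0, 0; 0, -1, 0, 0])) ∧ ∀ σ, (ρ σ = 1 ↔ ∃ c : ZMod 3, (ρt σ).val =
c • (1 : Matrix (Fin 4) (Fin 4) (ZMod 3)))) ∧ (∀ g h : Matrix (Fin 5) (Fin 5) (ZMod 3), gᵀ * g = 1 →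
g.det = 1 → hᵀ * h = 1 → h.det = 1 → ∃ σ, (ρ.restrictField (CyclotomicField 3 ℚ) σ).val = g * h *
g⁻¹ * h⁻¹) ∧ FramedRep.IsAbsolutelyIrreducible (𝓢.rep «λ») ∧ (∀ v : HeightOneSpectrum (𝓞
(CyclotomicField 3 ℚ)), (3 : 𝓞 (CyclotomicField 3 ℚ)) ∈ v.asIdeal → ∀ 𝔓 ∈ v.primesAbove, ∃ (φ :
PadicInt 3 →+* «λ».adicCompletion E) (a : ℤ) (Q : GL (Fin 5) («λ».adicCompletion E)) (U : Subgroup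
(absoluteGaloisGroup (CyclotomicField 3 ℚ))), IsOpen (U : Set (absoluteGaloisGroup (CyclotomicField
3 ℚ))) ∧ (∀ σ : absoluteGaloisGroup (CyclotomicField 3 ℚ), (∀ x ∈ 𝔓, σ • x ∈ 𝔓) → (Q⁻¹ * 𝓢.rep «λ» σ
* Q).val.BlockTriangular ![0, 1, 1, 1, 2]) ∧ ∀ σ ∈ 𝔓.inertia (absoluteGaloisGroup (CyclotomicField 3
ℚ)), σ ∈ U → (Q⁻¹ * 𝓢.rep «λ» σ * Q).val 0 0 = φ (GaloisRep.cyclotomicCharacter (CyclotomicField 3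
ℚ) 3 σ).val ^ a ∧ (Q⁻¹ * 𝓢.rep «λ» σ * Q).val 4 4 = φ (GaloisRep.cyclotomicCharacter
(CyclotomicField 3 ℚ) 3 σ).val ^ (a - 1) ∧ ∃ c : «λ».adicCompletion E, ∀ i j : Fin 5, i ≠ 0 → i ≠ 4
→ j ≠ 0 → j ≠ 4 → (Q⁻¹ * 𝓢.rep «λ» σ * Q).val i j = if i = j then c else 0) ∧ (∀ᶠ v :
HeightOneSpectrum (𝓞 (CyclotomicField 3 ℚ)) in cofinite, ∃ P₀ : Polynomial (𝓞 E), P₀.map (algebraMap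
(𝓞 E) E) = 𝓢.charpoly v ∧ ∀ 𝔓 ∈ v.primesAbove, ∀ σ : absoluteGaloisGroup (CyclotomicField 3 ℚ),
IsArithFrobAt (𝓞 (CyclotomicField 3 ℚ)) σ 𝔓 → (ρ.restrictField (CyclotomicField 3 ℚ)
σ).val.charpoly.map j = P₀.map (Ideal.Quotient.mk «λ».asIdeal))) → (∃ a : ℤ, ∀ σ : (CyclotomicField
3 ℚ) ≃ₐ[ℚ] (CyclotomicField 3 ℚ), σ ≠ AlgEquiv.refl → ∀ v w : HeightOneSpectrum (𝓞 (CyclotomicField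
3 ℚ)), v ∉ 𝓢.bad → w ∉ 𝓢.bad → w.asIdeal = Ideal.comap (RingOfIntegers.mapRingHom
σ.toRingEquiv.toRingHom) v.asIdeal → 𝓢.charpoly w = C ((𝓢.charpoly v).coeff 0)⁻¹ * ((𝓢.charpoly
v).comp (C ((v.residueCard : E) ^ a) * X)).reverse) → ∀ (emb : E →+* ℂ) (hcpt :
isCompact_glFiniteIntegralLevel 5 (CyclotomicField 3 ℚ)), ∃ π : CuspidalAutomorphicRepData 5
(CyclotomicField 3 ℚ) hcpt, π.1.IsLAlgebraic ∧ ∀ᶠ v : HeightOneSpectrum (𝓞 (CyclotomicField 3 ℚ)) in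
cofinite, ∃ α : Multiset ℂ, π.1.HasSatakeParamAt v α ∧ (𝓢.charpoly v).map emb = (α.map fun a ↦ X - C
a⁻¹).prod`

## Assembly
Pure logic, CHECKED (Sketch.lean `closes`, lean check rc 0, 0 sorry, 2026-08-15): given the target's
data (λ, j, ρ̄) put
ρ̄_K := ρ̄.restrictField K; orthogonality of ρ̄_K is that of ρ̄ (`restrictField_apply` is rfl);
residual automorphy of ρ̄_K is
E6ResidualTransport applied to the seven E₆-type clauses (incl. liftability); the commutator,
irreducibility, μ-ordinary-shape, reduction and polarisation
clauses pass verbatim; PolarisedLiftingRank5 concludes X; SectorComplement turns X into `Langlands`.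
The bookkeeping item `Assembly`
(cruxes → target) is the same proof without the last step. E6TypeRealised is not a hypothesis of
`closes` (it guards non-vacuity).

Rationale: WHY THIS LINE. One finite group of order 51840 is at once the symmetry group of the 27 lines, the
reduction mod (1−ω) of the Allcock–Carlson–Toledo
Eisenstein lattice H³(T_S, ℤ) of signature (4,1) (Galois-equivariantly: Achter2020), and PGSp₄(𝔽₃),
the projective 3-torsion monodromy of
principally polarised abelian surfaces: W(E₆) ≅ SO₅(𝔽₃) ≅ PGSp₄(𝔽₃), the isogeny B₂ = C₂ being
realised by ∧²₀ in characteristic 3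
(support items WeylE6IsoSO5F3, Sp4F3OntoOmega5). Reading BCGP2025ModularityAbelianSurfaces §9.3–9.5
in the held text (arXiv:2502.20645,
Lemma 413, Lemma 416 "switching", proof of Thm 420) shows the paper proves RESIDUAL modularity of
every abstract ρ̄ : Γ_ℚ → GSp₄(𝔽₃) with
similitude ε̄⁻¹, dual ordinary finite flat at 3, unramified at 2 with Frob₂ not of class 4C/12C —
with NO big-image hypothesis (P(ρ̄) is
rational, BoxerEtAl2021; weak approximation + thin sets give B = Jac(X)/ℚ with B[3] ≅ ρ̄, modular by
the 2-adic theorem); the similitude of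
any GSp₄(𝔽₃)-lift of the twisted 27-line representation is FORCED to be its spinor parity, and the
parity clause forces complex conjugation
and the inertia generator at 3 into the hyperbolic trace-1 class, whose lift is diag(−1,−1,1,1):
exactly BCGP's local shape (bookkeeping of
the retired route, re-derived in NOTES.md). Hida theory (Pilloni2012), Arthur for GSp₄
(GeeTaibi2019), Kim2002's ∧² and cyclic base change
(ArthurClozel1989) then land a regular algebraic cuspidal Π on GL₅(𝔸_K) congruent to ρ̄|Γ_K:
residual automorphy of the occult
U(4,1)-motive of a generic cubic surface — imported from the arithmetic of genus-2 curves through an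
exceptional isomorphism of finite
groups (geometric/motivic lift + exceptional isogeny; no analytic or probabilistic reformulation is
used). Downstream is the rank-5,
RAMIFIED-prime analogue of the BCGP irregular-weight machine on the ACT ball quotient, typed here
(unlike the retired route, which had no
condition at λ) as a μ-ordinary statement through a junk-free shape clause (blocks (1,3,1),
cyclotomic powers on sub/quotient); the
negatives index (1 entry, K3KugaSatakeDescent) is not touched.

RANKED CRUXES. #0 OccultTypeAutomorphy (target) — Thesis X of § Thesis: occult-type (absolutely
irreducible at λ ∣ 3, liftable E₆ residual type, μ-ordinary occult shape at the prime over 3,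
polarised) rank-5 compatible systems over K = ℚ(ω) are automorphic (a.e. Satake matching with an
L-algebraic cuspidal π on GL₅(𝔸_K), for every coefficient embedding and every hcpt). Direction (B),
n = 5, K = ℚ(ω), irregular weight; LGC at the finitely many remaining places deliberately not in X
(convention of the other sector routes). (why it might fail: Every crux below can fail; worse, the
class may be EMPTY for cubic surfaces: T_S never has good reduction at 3 (μ₃-cover in characteristic
3), so no occult system may have μ-ordinary shape at λ — then X is vacuous for its intended members
(kill criterion c).) [AllcockCarlsonToledo2002, Achter2020, BCGP2025ModularityAbelianSurfaces,
BuzzardGeeLMS2014]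
#2 E6ResidualTransport (crux) — THE TRANSPORT (card D1): every ρ̄ : Γ_ℚ → SO₅(𝔽₃) (gᵀg = 1, det 1,
standard form) which is surjective, has spinor parity ε̄ (σ fixes ζ₃ iff ρ̄(σ) ∈ ⟨squares of O₅(𝔽₃)⟩
= Ω₅(𝔽₃)), tr ρ̄(c) = 1 for complex conjugations, is unramified at 2 with Frobenius polynomial ≠
(X−1)³(X²+1) (⇔ the GSp₄-lift of Frob₂ is not of class 4C/12C, BCGP2025 Lemma 416/Thm 420), and
whose inertia at 3 acts through {1, t} non-trivially with t² = 1, tr t = 1 (⇒ GSp₄-lift ε̄U₁ ⊕ U₂: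
split ordinary, finite flat, BCGP2025 Lemma 413), and (vii, NEW) which LIFTS: there is a continuous
ρ̃ : Γ_ℚ → GSp₄(𝔽₃) (g ↦ gᵀJg = νJ) with ρ̃⁻¹(centre) = ker ρ̄ — given surjectivity and Aut SO₅(𝔽₃)
= Inn this is exactly liftability through the exceptional isomorphism PGSp₄(𝔽₃) ≅ SO₅(𝔽₃) (the
retired route wrongly took the Br(ℚ)[2] obstruction to vanish — it is a sum of local conditions at
ALL ramified primes, e.g. two Frobenius-conjugate nodes at p obstruct — so it is now a hypothesis),
is RESIDUALLY AUTOMORPHIC OF REGULAR WEIGHT over K: for every hcpt there are a regular algebraic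
cuspidal π on GL₅(𝔸_K), a subring 𝒪 ⊂ ℂ holding its q²-normalised Hecke polynomials a.e. and θ : 𝒪 →
k ⊇ 𝔽₃ reducing them to the characteristic polynomials of ρ̄|Γ_K at geometric Frobenius. Chain: the
lift ρ̃ has ν = spinor parity = ε̄ (forced), ρ̃(c) ~ diag(1,1,−1,−1), ρ̃|Γ_ℚ₃ = ε̄U₁ ⊕ U₂; BCGP2025
switching ⇒ B = Jac(X)/ℚ with B[3] ≅ lift, good ordinary at 3, B modular (2-adic theorem, image
S₅(b) arranged by thin-set avoidance: no big-image hypothesis needed); Hida family (Pilloni2012) ⇒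
regular ordinary Siegel g with ρ̄_g ≅ lift; Arthur GSp₄ → GL₄ (GeeTaibi2019); Kim2002 ∧² = ν ⊞ Π₅,
Π₅ cuspidal regular algebraic (∧²₀ residually absolutely irreducible); cyclic base change to K
(ArthurClozel1989) kills ε̄; Galois representations of RACSDC Π (ClozelHarrisTaylor2008) certify the
congruence. [difficulty: L] (why it might fail: Five unvendored theorems in a row (BCGP2025 Lem
413/416 + 2-adic modularity; Hida to regular weight; Arthur GSp4→GL4; Kim ∧²; cyclic BC) and an
integral Hecke congruence; a slip in the ν = spinor / Frob₂-class / split-ordinary-at-3 dictionary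
breaks it.) [BCGP2025ModularityAbelianSurfaces, arXiv:2502.20645, BoxerEtAl2021, Pilloni2012,
GeeTaibi2019, Kim2002, ArthurClozel1989, ClozelHarrisTaylor2008]
#3 PolarisedLiftingRank5 (crux) — μ-ORDINARY IRREGULAR LIFTING IN RANK 5 OVER K (card D2+D3+D4, the
hardest node): every rank-5 weakly compatible system 𝓢 over K = ℚ(ω) which at some λ ∣ 3 (i) reduces
a.e. to ρ̄_K : Γ_K → SO₅(𝔽₃) whose image contains every commutator of SO₅(𝔽₃) (⊇ Ω₅(𝔽₃) ≅ PSp₄(𝔽₃))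
and which is residually automorphic of regular weight (verbatim the conclusion of
E6ResidualTransport), (ii) is absolutely irreducible at λ, (iii) has μ-ORDINARY OCCULT SHAPE at the
prime 𝔓 over 3: a ring map φ : ℤ₃ → E_λ (unique, exists iff λ ∣ 3), an integer a, a frame Q and an
open U ≤ Γ_K with Q⁻¹ρ(σ)Q block upper triangular of type (1,3,1) for every σ stabilising 𝔓, and for
σ in inertia ∩ U: entry (0,0) = φ(ε(σ))^a, entry (4,4) = φ(ε(σ))^(a−1), middle 3×3 block scalar (the
potentially-μ-ordinary shape of labelled Hodge–Tate type {0,1,1,1,1}/{0,0,0,0,1} up to Tate twist,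
stated without Artin data), and (iv) is polarised, is automorphic (∃ L-algebraic cuspidal π on
GL₅(𝔸_K) matching 𝓢.charpoly a.e., for every embedding and hcpt). INTENDED PROOF: μ-ordinary higher
Hida theory for GU(4,1)/ℚ on integral models of the Allcock–Carlson–Toledo ball quotient at the
ramified prime 3, irregular-weight R = 𝕋 patched on perfect complexes of ordinary coherent
cohomology (BoxerEtAl2021/CalegariGeraghty2017 template), Sen = Cousin classicality à la BCGP2025
§§3–5 for the singular weight, de Rhamness of the limit; this is the node to SPLIT first in tenure.
[deps: E6ResidualTransport] [difficulty: open-problem] (why it might fail: No engine exists: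
μ-ordinary higher Hida theory, irregular-weight R = 𝕋 and Sen/Cousin classicality for GU(4,1) at the
RAMIFIED prime 3 (BCGP did GSp4/ℚ); residual image PSp4(𝔽₃) with p = 3 ∣ #image may fail adequacy;
weakly compatible systems carry no de Rham clause.) [BCGP2025ModularityAbelianSurfaces,
BoxerEtAl2021, BoxerPilloni2021HigherColeman, CalegariGeraghty2017,
Literature.Barriers.Langlands.NonRegularWeightBarrier, arXiv:2602.22189]
#4 E6TypeRealised (crux) — NON-VACUITY OF THE TRANSPORT CLASS (new, typed part of card D1(c)/the
retired informal crux): there EXISTS a continuous ρ̄ : Γ_ℚ → SO₅(𝔽₃) with all seven hypotheses of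
E6ResidualTransport (surjective; spinor parity = ε̄; tr ρ̄(c) = 1; unramified at 2 with Frobenius
polynomial ≠ (X−1)³(X²+1); inertia at 3 = {1,t}, t² = 1, tr t = 1, non-trivial; a continuous
GSp₄(𝔽₃)-valued ρ̃ with ρ̃⁻¹(centre) = ker ρ̄). Intended witness: ρ̄ = det(ρ̄₂₇)·ρ̄₂₇ for the 27
lines of a smooth cubic surface S/ℚ with Gal(ℚ(lines)/ℚ) = W(E₆), Δ(S) ∈ ℚ^{×2} (ElsenhansJahnel2011
Thm 2.12: the quadratic subfield of ℚ(lines) is ℚ(√(−3Δ)), so parity = ε̄ iff Δ is a square; this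
FORCES bad reduction at 3), exactly 3 real lines (c of type A₁³), good reduction at 2 off the
excluded Frobenius class, and reduction at 3 with three conjugate nodes of odd depth (tame inertia
acting through one A₁³ involution) and vanishing local lifting obstructions at every bad prime
(lifts of two commuting twisted reflections generate Q₈, so e.g. a prime with two
Frobenius-conjugate nodes is forbidden); any W(E₆)-polynomial with these local types also proves it.
Refutable by a global incompatibility of the prescribed local types; its refutation kills the line
over ℚ (pivot: F = ℚ(√Δ) totally real, BCGP over totally real fields). [difficulty: M] (why it might
fail: Square discriminant + full W(E₆) + 3 real lines + A₁³ inertia at 3 + Frob₂ condition +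
vanishing Br(ℚ)[2] lifting obstruction at every bad prime may be jointly unrealisable (δ² = Δ(S) is
thin; parity constraints couple the places); no such W(E₆)-field is on record.)
[ElsenhansJahnel2011, zbl:1346.11039, BCGP2025ModularityAbelianSurfaces, Hunt1996, arXiv:2509.06785]
#9 SectorComplement (support) — OUT-OF-SCOPE REMAINDER = the rest of the summit:
`OccultTypeAutomorphy → Langlands`. NOT attacked by this route and not expected to close before the
summit itself; filed only so that the deciding theorem `closes : E6ResidualTransport →
PolarisedLiftingRank5 → SectorComplement → _root_.Langlands` honestly concludes the summit constant
(D-0027 §2.1; same convention as E8QuinticResidue.SectorComplement,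
GaloisWeightedBE.SectorComplement, CapacityClassicality.SectorToLanglands: the summit shape `∀ F ∃ 𝓡
∀ n, (A) ∧ (B)` cannot follow from one sector). It contains everything this thesis does not claim:
direction (A), every (n, F) ≠ (5, ℚ(ω)), every ρ outside the occult class, local–global
compatibility at every finite place and the reciprocity data 𝓡 even inside the sector. Trivially
implied by `Langlands`. Refuters/graders: judge the route on E6ResidualTransport /
PolarisedLiftingRank5 / E6TypeRealised, never on this item; never staffed from this route.
[difficulty: open-problem] [BuzzardGeeLMS2014, FontaineMazurGeometric1995]
#9 WeylE6IsoSO5F3 (support) — Dictionary, first half (finite, kernel-checkable): the Coxeter group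
of type E₆ (Mathlib `CoxeterMatrix.E₆.Group`, |W| = 51840) is isomorphic to SO₅(𝔽₃) = {g ∈ GL₅(𝔽₃) |
gᵀg = 1, det g = 1}, via w ↦ det(w)·w on (E₆/3E₆)/radical = Λ_S/(1−ω)Λ_S [AllcockCarlsonToledo2002;
Bourbaki Lie VI §4 Ex. 2; ATLAS U₄(2) ≅ S₄(3) ≅ O₅(3); Hunt1996 Ch. 5–6; Dolgachev2012 Ch. 9]. Route
to a proof: six elements det(r)·r, r the reflections of an E₆ diagram of norm-(−1) vectors, braid
relations via PresentedGroup.toGroup, injectivity from simplicity of W(E₆)′ plus an order count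
(decide/native computation only within the gate's axiom whitelist). [difficulty: provable-now]
[Hunt1996, Dolgachev2012, AllcockCarlsonToledo2002]
#9 Sp4F3OntoOmega5 (support) — Dictionary, second half (exceptional isogeny B₂ = C₂ realised by ∧²₀
in characteristic 3): a homomorphism Sp₄(𝔽₃) (Mathlib `Matrix.symplecticGroup (Fin 2) (ZMod 3)`) →
GL₅(𝔽₃) with kernel {±1} and image Ω₅(𝔽₃) = ⟨squares of SO₅(𝔽₃)⟩ (index 2, ≅ PSp₄(𝔽₃) ≅ W(E₆)′,
simple of order 25920). Construction: g ↦ ∧²g on ω^⊥ ⊂ ∧²(𝔽₃⁴) = ⟨ω⟩ ⊥ (5-dim), non-degenerate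
because ω∧ω ≠ 0 (2 ≠ 0 in 𝔽₃); the similitude version PGSp₄(𝔽₃) ≅ SO₅(𝔽₃) is 'ν = spinor norm', the
identity that forces the similitude of every lift in E6ResidualTransport; completeness Aut SO₅(𝔽₃) =
Inn turns the kernel form of clause (vii) into an honest lift [Hunt1996, Dolgachev2012].
[difficulty: provable-now] [Hunt1996, Dolgachev2012]

TWO-LAYER PLAN. Foreseen glued splits, filed only when a crux closes or a definition lands (k ≤ 3,
depth 1): PolarisedLiftingRank5 ⇐ MuOrdHigherHidaU41
(μ-ordinary higher Hida theory for GU(4,1)/ℚ at p = 3 on the ACT ball quotient: ordinary perfect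
complex in degrees 0–1, control, families)
→ IrregularRTU41 (R^{P-ord} = 𝕋 on the patched complex, residual image Ω₅(𝔽₃), Ihara avoidance as in
BCGP) → SenCousinClassicalityU41
(classicality + de Rhamness of the singular-weight limit form, giving the L-algebraic π);
E6ResidualTransport ⇐ TateLiftE6 (the GSp₄(𝔽₃)
lift with ν = ε̄ and BCGP's local shape at 2, 3, ∞) → ResidualFromBCGP (B modular, Hida, GL₄, ∧²,
BC) → the congruence bookkeeping;
E6TypeRealised ⇐ one explicit cubic surface (kit: 27 lines, discriminant, reduction types) or one
explicit degree-27 polynomial.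

KILL CRITERIA. (a) ¬E6TypeRealised proved (the six local clauses are globally incompatible): the
transport class over ℚ is empty — close
`refuted:E6TypeRealised` unless the pivot F = ℚ(√Δ(S)) totally real (BCGP over totally real fields,
BoxerEtAl2021 + its 2025 sequel) is
typed within the grace window. (b) ¬E6ResidualTransport by an explicit ρ̄ (e.g. the P(ρ̄)(ℚ₃)-point
or ν-bookkeeping fails for an
admissible local type): repair once if misstated (finite computation over 𝔽₃/ℚ₃ names the missing
clause), else close. (c) The informal
cubic-content crux returns "no cubic surface has an occult system of μ-ordinary shape at λ": X keeps
no geometric member — close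
`exhausted` or pivot to a potentially-semistable (non-ordinary) host, which no current technique
reaches. (d) ¬PolarisedLiftingRank5 as
typed AND no typed μ-ordinary restatement survives. Proved elsewhere: direction (B) for n = 5 over
CM fields in irregular weight moots the route.

NOT DECOMPOSED YET. The higher-Hida / R = 𝕋 / classicality interior of PolarisedLiftingRank5 (split
only after E6ResidualTransport closes or the GU(4,1)
integral-model definitions land); local–global compatibility at the finitely many bad places and at
λ (not in X); the cubic-surface
content itself (no Lean carrier for cubic surfaces, the 27 lines or étale H³: filed as an informal
rank-5 crux right after open, with
definition requests); the weight-0 Artin motive of S (the 6-dimensional reflection representation: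
HT weight 0, NonRegularWeight wall —
explicitly NOT claimed); adequacy of Ω₅(𝔽₃) ⊂ GL₅(𝔽̄₃) at p = 3 (a named check inside the rank-3
node).

CHEAPEST FALSIFIER. E6TypeRealised by computer algebra (a refuter's first job; kit not run in this
planning seat): take cubic surfaces S/ℚ with full W(E₆)
action on the lines (arXiv:2509.06785 and ElsenhansJahnel2011 give families and the discriminant),
filter Δ(S) ∈ ℚ^{×2}, exactly 3 real
lines, good reduction at 2 with Frobenius polynomial on (E₆/3E₆)/rad ≠ (X−1)³(X²+1), three conjugate
nodes mod 3, and at every other bad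
prime a decomposition-group image whose preimage in GSp₄(𝔽₃) splits (local Tate obstruction 0); ONE
hit proves the
rank-4 crux, a structural reason for zero hits (e.g. Δ square ⇒ constraint at 3 or ∞) refutes the
line over ℚ. Second: recompute the
dictionary 4C/12C ↔ (X−1)³(X²+1) and 'trace-1 involution outside Ω₅ ↦ diag(−1,−1,1,1), ν = −1' in
GAP (W(E₆) ≅ SO₅(3) character table).

NUMBERS. |W(E₆)| = |SO₅(𝔽₃)| = |PGSp₄(𝔽₃)| = 51840; |Ω₅(𝔽₃)| = |PSp₄(𝔽₃)| = 25920; occult lattice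
H³(T_S, ℤ): rank 10, ℤ[ω]-rank 5, signature
(4,1) (AllcockCarlsonToledo2002); h^{2,1}(T_S) = 5 = 4 + 1; labelled HT type
{0,1,1,1,1}/{0,0,0,0,1}; real cubic surfaces have 27, 15, 7, 3
or 3 real lines (c of type 1, A₁, A₁², A₁³); BCGP2025 excluded Frob₂ classes 4C, 12C ↔
GSp₄-polynomial (x² ± x + 2)² ↔ SO₅-polynomial
(X−1)³(X²+1); items at open: 8 (target, 3 cruxes, 3 support, assembly) + 1 informal crux filed after
open.

DEFINITION REQUESTS. Filed/wanted (informal crux depends on them): `CubicSurface` (smooth cubic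
surface over a field, its 27 lines as a finite étale
Γ-set, the E₆ lattice structure on Pic), `CubicSurface.linesOrthogonalRep : FramedGaloisRep ℚ (ZMod
3) 5` (det-twisted action on
(E₆/3E₆)/rad), `CubicSurface.occultSystem : CompatibleSystem (CyclotomicField 3 ℚ) (CyclotomicField
3 ℚ) 5` (λ-adic H³ of the cyclic
cubic threefold, ω-eigenspace) — topic Literature/AlgebraicGeometry or
Summits/Langlands/Langlands/Theorems. Landed already and NOT used
(junk Artin data): `FramedGaloisRep.IsPOrdinaryAt`
(Literature.NumberTheory.GaloisRepresentations.POrdinaryGaloisRep); the shape clause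
of PolarisedLiftingRank5 is its Artin-datum-free shadow.

Novelty: Searches (2026-08-15, this seat): `lit read arxiv:2502.20645 --grep 'switch|4C|12C|finite flat'`
(pp. 133–136: Lemma 413, Cor. 412,
Lemma 416, Thm 419–420 read in full); `lit search --source zbmath "occult period cubic surface cubic
threefold Galois representation
automorphic"` (0); `lit search --source zbmath "discriminant cubic surface Galois group 27 lines"`
(1: zbl:1346.11039 Elsenhans–Jahnel
2012, arithmetic of the discriminant — geometry/Galois only); `lit search --source arxiv "higher
Hida theory unitary Shimura variety
signature irregular weight" --year-from 2019` (0); `lit frontier Langlands --since 2024` (30 rows;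
nearest: arXiv:2602.04778 R = T for
orthogonal Shimura varieties — regular weight, different group; arXiv:2008.09852 residual automorphy
for the Dwork quintic family mod 2
— a transport of the same flavour for a different family/prime); `ledger negatives --problem
Langlands` (1, unrelated); plus the card's
and the retired route's recorded sweeps (zbMATH/Crossref/galaxy: ACT 2002, Achter 2020, Beauville,
Matsumoto–Terasoma, Hunt1996,
PichonPharabodTelen arXiv:2509.06785 — none automorphic). searchd hybrid/galaxy was unavailable (rc
75) during this seat.
Nearest prior art found: BCGP2025ModularityAbelianSurfaces (arXiv:2502.20645 §9.3–9.5: residual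
modularity of abstract ρ̄ : Γ_ℚ →
GSp₄(𝔽₃) via rational P(ρ̄), the theorem transported); AllcockCarlsonToledo2002
(doi:10.1090/s1056-3911-02-00314-4) + Achter2020
(doi:10.14231/ag-2020-021): the occult motive and  [refs: 10.1090/s1056-3911-02-00314-4, 10.14231/ag-2020-021, 10.1007/s10711-011-9643-7, 2502.20645, 2602.04778, 2008.09852, 2509.06785, arxiv:2502.20645, doi:10.1090/s1056-3911-02-00314-4, doi:10.14231/ag-2020-021, doi:10.1007/s10711-011-9643-7, Hunt1996, AllcockCarlsonToledo2002, Achter2020, ElsenhansJahnel2011]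

Barriers (technique_class: higher-hida irregular-weight automorphy-lifting): - technique_class: higher-hida irregular-weight automorphy-lifting
- Literature.Barriers.Langlands.NonRegularWeightBarrier: MET head-on (occult HT type
{0,1,1,1,1}/{0,0,0,0,1}); evasion = the catalogued one (BCGP): coherent cohomology of the ACT ball
quotient in two degrees + higher Hida theory + Sen = Cousin classicality, now restricted to the
μ-ordinary shape typed in PolarisedLiftingRank5; the weight-0 Artin motive of S is NOT claimed.
- Literature.Barriers.Langlands.TaylorWilesNumericalCoincidence: U(4,1)/ℚ has a Shimura variety; the
irregular-weight defect is paid by patching perfect complexes of ordinary coherent cohomology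
(Calegari–Geraghty/BCGP), the catalogued evasion; no GL_n-over-CM defect since the system is
polarised (clause (iv)).
- Literature.Barriers.Langlands.TaylorWilesNumericalCoincidenceNarrow: base ℚ, polarised rank 5 —
inside the narrow form's admissible regime; recorded, not fought.
- Literature.Barriers.Langlands.PatchingLocalComponentBarrier: met at λ = (1−ω): the bet is a single
P-ordinary component for the typed (1,3,1) shape; cubic surfaces off that shape are conceded (kill
criterion c).
- Literature.Barriers.Langlands.ResiduallyReducibleBarrier: evaded by hypothesis: residual image ⊇
Ω₅(𝔽₃) ≅ PSp₄(𝔽₃), absolutely irreducible on 𝔽₃⁵; adequacy at p = 3 (p ∣ #image) is a named check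
inside the rank-3 node; non-surjective 27-line groups are outside the class.
- Literature.Barriers.Langlands.ShimuraVarietyRealizationBarrier: respected — K = ℚ(ω) is CM

History (route lifecycle, newest last):
- 2026-08-22T10:31:38Z · DORMANT — reconciler: no traction for 5.3 d (last activity item-evidence-added at 2026-08-17T03:13:47Z); parked, not closed — `ledger route dormant route-Langlands-Occult (operator:999:3728198)

sub-problem: Langlands · status: dormant · opened planner-plancard-Langlands-Langlands-cubic-su-8ab83e6d-g2-0 2026-08-15T19:06:45Z · rev 3 · ledger route-Langlands-OccultE6Transport
GENERATED by the gate from the ledger (D-0016/17). Provers cite these decls: `theorem foo : Summit.Langlands.Langlands.Theses.OccultE6Transport.<Decl> := …` in Summits/Langlands/Langlands/Theorems/<Name>.lean.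
-/

namespace Summit.Langlands.Langlands.Theses.OccultE6Transport

open scoped BigOperators Topology Manifold Classical MeasureTheory ProbabilityTheory Matrix InnerProductSpace ComplexConjugate ContinuousMap
open Filter Set Function TopologicalSpace MeasureTheory

attribute [summit_statement] _root_.Langlands

/-- item stmt-Langlands-14221 · target · rank 0 · open · by planner
why it might fail: Inherits every risk of PolarisedLiftingRank5 (no GU(4,1) engine at ramified 3; no de Rham clause, middle weight free; adequacy of Ω₅(𝔽₃) at p=3) and may be VACUOUS for its intended members: T_S is a μ₃-cover, bad at 3, so no occult system may have μ-ordinary shape at λ∣3 (kill criterion c, 14877).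
sources: AllcockCarlsonToledo2002, Achter2020, BCGP2025ModularityAbelianSurfaces, arXiv:2502.20645, BuzzardGeeLMS2014, Literature.Barriers.Langlands.NonRegularWeightBarrier
[target] Thesis X of § Thesis: occult-type (absolutely irreducible at λ ∣ 3, liftable E₆ residual
type, μ-ordinary occult shape at the prime over 3, polarised) rank-5 compatible systems over K =
ℚ(ω) are automorphic (a.e. Satake matching with an L-algebraic cuspidal π on GL₅(𝔸_K), for every
coefficient embedding and every hcpt). Direction (B), n = 5, K = ℚ(ω), irregular weight; LGC at the
finitely many remaining places deliberately not in X (convention of the other sector routes). -/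
@[route_item "route-Langlands-OccultE6Transport"]
def OccultTypeAutomorphy : Prop :=
  open Literature.NumberTheory.GaloisRepresentations Literature.NumberTheory.Automorphic Polynomial NumberField IsDedekindDomain Field in ∀ (E : Type) [Field E] [NumberField E] (𝓢 : CompatibleSystem (CyclotomicField 3 ℚ) E 5), (∃ («λ» : HeightOneSpectrum (𝓞 E)) (j : ZMod 3 →+* 𝓞 E ⧸ «λ».asIdeal) (ρ : FramedGaloisRep ℚ (ZMod 3) 5), (∀ σ, (ρ σ).valᵀ * (ρ σ).val = 1 ∧ (ρ σ).val.det = 1) ∧ (∀ g : Matrix (Fin 5) (Fin 5) (ZMod 3), gᵀ * g = 1 → g.det = 1 → ∃ σ, (ρ σ).val = g) ∧ (∀ (σ : absoluteGaloisGroup ℚ) (ζ : AlgebraicClosure ℚ), ζ ^ 2 + ζ + 1 = 0 → (σ • ζ = ζ ↔ ρ σ ∈ Subgroup.closure ((fun x : GL (Fin 5) (ZMod 3) ↦ x * x) '' {x : GL (Fin 5) (ZMod 3) | x.valᵀ * x.val = 1}))) ∧ (∀ (φ : ℚ →+* ℝ) (c : absoluteGaloisGroup ℚ), IsComplexConjugation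 φ c → (ρ c).val.trace = 1) ∧ (∀ v : HeightOneSpectrum (𝓞 ℚ), (2 : 𝓞 ℚ) ∈ v.asIdeal → ρ.IsUnramifiedAt v ∧ ∀ P, ρ.HasFrobCharpolyAt v P → P ≠ (X - 1) ^ 3 * (X ^ 2 + 1)) ∧ (∀ v : HeightOneSpectrum (𝓞 ℚ), (3 : 𝓞 ℚ) ∈ v.asIdeal → ∀ 𝔓 ∈ v.primesAbove, ∃ t : Matrix (Fin 5) (Fin 5) (ZMod 3), t * t = 1 ∧ t.trace = 1 ∧ (∀ σ ∈ 𝔓.inertia (absoluteGaloisGroup ℚ), (ρ σ).val = 1 ∨ (ρ σ).val = t) ∧ (∃ σ ∈ 𝔓.inertia (absoluteGaloisGroup ℚ), (ρ σ).val = t)) ∧ (∃ ρt : FramedGaloisRep ℚ (ZMod 3) 4, (∀ σ, (∃ ν : ZMod 3, ν ≠ 0 ∧ (ρt σ).valᵀ * !![0, 0, 1, 0; 0, 0, 0, 1; -1, 0, 0, 0; 0, -1, 0, 0] * (ρt σ).val = ν • !![0, 0, 1, 0; 0, 0, 0, 1; -1, 0, 0, 0; 0, -1, 0, 0])) ∧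 ∀ σ, (ρ σ = 1 ↔ ∃ c : ZMod 3, (ρt σ).val = c • (1 : Matrix (Fin 4) (Fin 4) (ZMod 3)))) ∧ (∀ g h : Matrix (Fin 5) (Fin 5) (ZMod 3), gᵀ * g = 1 → g.det = 1 → hᵀ * h = 1 → h.det = 1 → ∃ σ, (ρ.restrictField (CyclotomicField 3 ℚ) σ).val = g * h * g⁻¹ * h⁻¹) ∧ FramedRep.IsAbsolutelyIrreducible (𝓢.rep «λ») ∧ (∀ v : HeightOneSpectrum (𝓞 (CyclotomicField 3 ℚ)), (3 : 𝓞 (CyclotomicField 3 ℚ)) ∈ v.asIdeal → ∀ 𝔓 ∈ v.primesAbove, ∃ (φ : PadicInt 3 →+* «λ».adicCompletion E) (a : ℤ) (Q : GL (Fin 5) («λ».adicCompletion E)) (U : Subgroup (absoluteGaloisGroup (CyclotomicField 3 ℚ))), IsOpen (U : Set (absoluteGaloisGroup (CyclotomicField 3 ℚ))) ∧ (∀ σ : absoluteGaloisGroup (CyclotomicField 3 ℚ), (∀ x ∈ 𝔓, σ • x ∈ 𝔓) → (Q⁻¹ * 𝓢.rep «λ» σ * Q).val.BlockTriangular ![0,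 1, 1, 1, 2]) ∧ ∀ σ ∈ 𝔓.inertia (absoluteGaloisGroup (CyclotomicField 3 ℚ)), σ ∈ U → (Q⁻¹ * 𝓢.rep «λ» σ * Q).val 0 0 = φ (GaloisRep.cyclotomicCharacter (CyclotomicField 3 ℚ) 3 σ).val ^ a ∧ (Q⁻¹ * 𝓢.rep «λ» σ * Q).val 4 4 = φ (GaloisRep.cyclotomicCharacter (CyclotomicField 3 ℚ) 3 σ).val ^ (a - 1) ∧ ∃ c : «λ».adicCompletion E, ∀ i j : Fin 5, i ≠ 0 → i ≠ 4 → j ≠ 0 → j ≠ 4 → (Q⁻¹ * 𝓢.rep «λ» σ * Q).val i j = if i = j then c else 0) ∧ (∀ᶠ v : HeightOneSpectrum (𝓞 (CyclotomicField 3 ℚ)) in cofinite, ∃ P₀ : Polynomial (𝓞 E), P₀.map (algebraMap (𝓞 E) E) = 𝓢.charpoly v ∧ ∀ 𝔓 ∈ v.primesAbove, ∀ σ : absoluteGaloisGroup (CyclotomicField 3 ℚ), IsArithFrobAt (𝓞 (CyclotomicField 3 ℚ)) σ 𝔓 → (ρ.restrictField (CyclotomicField 3 ℚ) σ).val.charpoly.map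 j = P₀.map (Ideal.Quotient.mk «λ».asIdeal))) → (∃ a : ℤ, ∀ σ : (CyclotomicField 3 ℚ) ≃ₐ[ℚ] (CyclotomicField 3 ℚ), σ ≠ AlgEquiv.refl → ∀ v w : HeightOneSpectrum (𝓞 (CyclotomicField 3 ℚ)), v ∉ 𝓢.bad → w ∉ 𝓢.bad → w.asIdeal = Ideal.comap (RingOfIntegers.mapRingHom σ.toRingEquiv.toRingHom) v.asIdeal → 𝓢.charpoly w = C ((𝓢.charpoly v).coeff 0)⁻¹ * ((𝓢.charpoly v).comp (C ((v.residueCard : E) ^ a) * X)).reverse) → ∀ (emb : E →+* ℂ) (hcpt : isCompact_glFiniteIntegralLevel 5 (CyclotomicField 3 ℚ)), ∃ π : CuspidalAutomorphicRepData 5 (CyclotomicField 3 ℚ) hcpt, π.1.IsLAlgebraic ∧ ∀ᶠ v : HeightOneSpectrum (𝓞 (CyclotomicField 3 ℚ)) in cofinite, ∃ α : Multiset ℂ, π.1.HasSatakeParamAt v α ∧ (𝓢.charpoly v).map emb = (α.map fun a ↦ X - C a⁻¹).prod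

/-- item stmt-Langlands-14222 · crux · rank 2 · open · by planner
why it might fail: BCGP2025 Lem 416/Thm 420 make B modular only in singular weight (2,2); a REGULAR-weight π needs Λ-adic higher-Hida/R=𝕋 control through that point, then Gee–Taïbi GSp₄→GL₄, Kim ∧² cuspidality, AC base change, CHT lattice congruence: 5 unvendored links; dictionary machine-checked, weight passage not.
sources: arXiv:2502.20645, BCGP2025ModularityAbelianSurfaces, BoxerEtAl2021, Pilloni2012, GeeTaibi2019, Kim2002
[crux] THE TRANSPORT (card D1): every ρ̄ : Γ_ℚ → SO₅(𝔽₃) (gᵀg = 1, det 1, standard form) which is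
surjective, has spinor parity ε̄ (σ fixes ζ₃ iff ρ̄(σ) ∈ ⟨squares of O₅(𝔽₃)⟩ = Ω₅(𝔽₃)), tr ρ̄(c) = 1
for complex conjugations, is unramified at 2 with Frobenius polynomial ≠ (X−1)³(X²+1) (⇔ the
GSp₄-lift of Frob₂ is not of class 4C/12C, BCGP2025 Lemma 416/Thm 420), and whose inertia at 3 acts
through {1, t} non-trivially with t² = 1, tr t = 1 (⇒ GSp₄-lift ε̄U₁ ⊕ U₂: split ordinary, finite
flat, BCGP2025 Lemma 413), and (vii, NEW) which LIFTS: there is a continuous ρ̃ : Γ_ℚ → GSp₄(𝔽₃) (g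
↦ gᵀJg = νJ) with ρ̃⁻¹(centre) = ker ρ̄ — given surjectivity and Aut SO₅(𝔽₃) = Inn this is exactly
liftability through the exceptional isomorphism PGSp₄(𝔽₃) ≅ SO₅(𝔽₃) (the retired route wrongly took
the Br(ℚ)[2] obstruction to vanish — it is a sum of local conditions at ALL ramified primes, e.g.
two Frobenius-conjugate nodes at p obstruct — so it is now a hypothesis), is RESIDUALLY AUTOMORPHIC
OF REGULAR WEIGHT over K: for every hcpt there are a regular algebraic cuspidal π on GL₅(𝔸_K), a
subring 𝒪 ⊂ ℂ holding its q²-normalised Hecke polynomials a.e. and θ : 𝒪 → k ⊇ 𝔽₃ reducing them to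
the characteristi -/
@[route_item "route-Langlands-OccultE6Transport", crux]
def E6ResidualTransport : Prop :=
  open Literature.NumberTheory.GaloisRepresentations Literature.NumberTheory.Automorphic Polynomial NumberField IsDedekindDomain Field in ∀ ρ : FramedGaloisRep ℚ (ZMod 3) 5, (∀ σ, (ρ σ).valᵀ * (ρ σ).val = 1 ∧ (ρ σ).val.det = 1) ∧ (∀ g : Matrix (Fin 5) (Fin 5) (ZMod 3), gᵀ * g = 1 → g.det = 1 → ∃ σ, (ρ σ).val = g) ∧ (∀ (σ : absoluteGaloisGroup ℚ) (ζ : AlgebraicClosure ℚ), ζ ^ 2 + ζ + 1 = 0 → (σ • ζ = ζ ↔ ρ σ ∈ Subgroup.closure ((fun x : GL (Fin 5) (ZMod 3) ↦ x * x) '' {x : GL (Fin 5) (ZMod 3) | x.valᵀ * x.val = 1}))) ∧ (∀ (φ : ℚ →+* ℝ) (c : absoluteGaloisGroup ℚ), IsComplexConjugation φ c → (ρ c).val.trace = 1) ∧ (∀ v : HeightOneSpectrum (𝓞 ℚ), (2 : 𝓞 ℚ) ∈ v.asIdeal → ρ.IsUnramifiedAt v ∧ ∀ P, ρ.HasFrobCharpolyAt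 v P → P ≠ (X - 1) ^ 3 * (X ^ 2 + 1)) ∧ (∀ v : HeightOneSpectrum (𝓞 ℚ), (3 : 𝓞 ℚ) ∈ v.asIdeal → ∀ 𝔓 ∈ v.primesAbove, ∃ t : Matrix (Fin 5) (Fin 5) (ZMod 3), t * t = 1 ∧ t.trace = 1 ∧ (∀ σ ∈ 𝔓.inertia (absoluteGaloisGroup ℚ), (ρ σ).val = 1 ∨ (ρ σ).val = t) ∧ (∃ σ ∈ 𝔓.inertia (absoluteGaloisGroup ℚ), (ρ σ).val = t)) ∧ (∃ ρt : FramedGaloisRep ℚ (ZMod 3) 4, (∀ σ, (∃ ν : ZMod 3, ν ≠ 0 ∧ (ρt σ).valᵀ * !![0, 0, 1, 0; 0, 0, 0, 1; -1, 0, 0, 0; 0, -1, 0, 0] * (ρt σ).val = ν • !![0, 0, 1, 0; 0, 0, 0, 1; -1, 0, 0, 0; 0, -1, 0, 0])) ∧ ∀ σ, (ρ σ = 1 ↔ ∃ c : ZMod 3, (ρt σ).val = c • (1 : Matrix (Fin 4) (Fin 4) (ZMod 3)))) → (∀ hcpt : isCompact_glFiniteIntegralLevel 5 (CyclotomicField 3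 ℚ), ∃ (π : CuspidalAutomorphicRepData 5 (CyclotomicField 3 ℚ) hcpt) (k : Type) (_ : Field k) (j : ZMod 3 →+* k) (𝒪 : Subring ℂ) (θ : 𝒪 →+* k), π.1.IsRegularAlgebraic ∧ ∀ᶠ v : HeightOneSpectrum (𝓞 (CyclotomicField 3 ℚ)) in cofinite, ∃ (α : Multiset ℂ) (P₀ : Polynomial 𝒪), π.1.HasSatakeParamAt v α ∧ P₀.map 𝒪.subtype = (α.map fun a ↦ X - C ((v.residueCard : ℂ) ^ 2 * a)).prod ∧ ∀ 𝔓 ∈ v.primesAbove, ∀ σ : absoluteGaloisGroup (CyclotomicField 3 ℚ), IsArithFrobAt (𝓞 (CyclotomicField 3 ℚ)) σ 𝔓 → (ρ.restrictField (CyclotomicField 3 ℚ) σ)⁻¹.val.charpoly.map j = P₀.map θ)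

/-- item stmt-Langlands-14223 · crux · rank 3 · open · by planner
why it might fail: No engine: higher Hida, irregular-weight R=𝕋, Sen–Cousin classicality exist for GSp₄/ℚ, not GU(4,1) at RAMIFIED 3; as typed the middle scalar character is free (no de Rham field: class ⊋ occult HT type), residual automorphy not asked polarised, one λ in → all emb out, adequacy of Ω₅(𝔽₃) at p=3 open.
sources: BCGP2025ModularityAbelianSurfaces, BoxerEtAl2021, Pilloni2020, BoxerPilloni2021HigherColeman, CalegariGeraghty2017, BrascaRosso2021
[crux] μ-ORDINARY IRREGULAR LIFTING IN RANK 5 OVER K (card D2+D3+D4, the hardest node): every rank-5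
weakly compatible system 𝓢 over K = ℚ(ω) which at some λ ∣ 3 (i) reduces a.e. to ρ̄_K : Γ_K →
SO₅(𝔽₃) whose image contains every commutator of SO₅(𝔽₃) (⊇ Ω₅(𝔽₃) ≅ PSp₄(𝔽₃)) and which is
residually automorphic of regular weight (verbatim the conclusion of E6ResidualTransport), (ii) is
absolutely irreducible at λ, (iii) has μ-ORDINARY OCCULT SHAPE at the prime 𝔓 over 3: a ring map φ :
ℤ₃ → E_λ (unique, exists iff λ ∣ 3), an integer a, a frame Q and an open U ≤ Γ_K with Q⁻¹ρ(σ)Q block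
upper triangular of type (1,3,1) for every σ stabilising 𝔓, and for σ in inertia ∩ U: entry (0,0) =
φ(ε(σ))^a, entry (4,4) = φ(ε(σ))^(a−1), middle 3×3 block scalar (the potentially-μ-ordinary shape of
labelled Hodge–Tate type {0,1,1,1,1}/{0,0,0,0,1} up to Tate twist, stated without Artin data), and
(iv) is polarised, is automorphic (∃ L-algebraic cuspidal π on GL₅(𝔸_K) matching 𝓢.charpoly a.e.,
for every embedding and hcpt). INTENDED PROOF: μ-ordinary higher Hida theory for GU(4,1)/ℚ on
integral models of the Allcock–Carlson–Toledo ball quotient at the ramified prime 3,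
irregular-weight R = 𝕋 patched on p -/
@[route_item "route-Langlands-OccultE6Transport", crux]
def PolarisedLiftingRank5 : Prop :=
  open Literature.NumberTheory.GaloisRepresentations Literature.NumberTheory.Automorphic Polynomial NumberField IsDedekindDomain Field in ∀ (E : Type) [Field E] [NumberField E] (𝓢 : CompatibleSystem (CyclotomicField 3 ℚ) E 5), (∃ («λ» : HeightOneSpectrum (𝓞 E)) (j : ZMod 3 →+* 𝓞 E ⧸ «λ».asIdeal) (ρK : FramedGaloisRep (CyclotomicField 3 ℚ) (ZMod 3) 5), (∀ σ, (ρK σ).valᵀ * (ρK σ).val = 1 ∧ (ρK σ).val.det = 1) ∧ (∀ g h : Matrix (Fin 5) (Fin 5) (ZMod 3), gᵀ * g = 1 → g.det = 1 → hᵀ * h = 1 → h.det = 1 → ∃ σ, (ρK σ).val = g * h * g⁻¹ * h⁻¹) ∧ (∀ hcpt : isCompact_glFiniteIntegralLevel 5 (CyclotomicField 3 ℚ), ∃ (π : CuspidalAutomorphicRepData 5 (CyclotomicField 3 ℚ) hcpt) (k : Type) (_ : Field k) (j : ZMod 3 →+* k) (𝒪 : Subring ℂ) (θ : 𝒪 →+*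 k), π.1.IsRegularAlgebraic ∧ ∀ᶠ v : HeightOneSpectrum (𝓞 (CyclotomicField 3 ℚ)) in cofinite, ∃ (α : Multiset ℂ) (P₀ : Polynomial 𝒪), π.1.HasSatakeParamAt v α ∧ P₀.map 𝒪.subtype = (α.map fun a ↦ X - C ((v.residueCard : ℂ) ^ 2 * a)).prod ∧ ∀ 𝔓 ∈ v.primesAbove, ∀ σ : absoluteGaloisGroup (CyclotomicField 3 ℚ), IsArithFrobAt (𝓞 (CyclotomicField 3 ℚ)) σ 𝔓 → (ρK σ)⁻¹.val.charpoly.map j = P₀.map θ) ∧ FramedRep.IsAbsolutelyIrreducible (𝓢.rep «λ») ∧ (∀ v : HeightOneSpectrum (𝓞 (CyclotomicField 3 ℚ)), (3 : 𝓞 (CyclotomicField 3 ℚ)) ∈ v.asIdeal → ∀ 𝔓 ∈ v.primesAbove, ∃ (φ : PadicInt 3 →+* «λ».adicCompletion E) (a : ℤ) (Q : GL (Fin 5) («λ».adicCompletion E)) (U : Subgroup (absoluteGaloisGroup (CyclotomicField 3 ℚ))), IsOpen (U : Set (absoluteGaloisGroup (CyclotomicField 3 ℚ))) ∧ (∀ σ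 : absoluteGaloisGroup (CyclotomicField 3 ℚ), (∀ x ∈ 𝔓, σ • x ∈ 𝔓) → (Q⁻¹ * 𝓢.rep «λ» σ * Q).val.BlockTriangular ![0, 1, 1, 1, 2]) ∧ ∀ σ ∈ 𝔓.inertia (absoluteGaloisGroup (CyclotomicField 3 ℚ)), σ ∈ U → (Q⁻¹ * 𝓢.rep «λ» σ * Q).val 0 0 = φ (GaloisRep.cyclotomicCharacter (CyclotomicField 3 ℚ) 3 σ).val ^ a ∧ (Q⁻¹ * 𝓢.rep «λ» σ * Q).val 4 4 = φ (GaloisRep.cyclotomicCharacter (CyclotomicField 3 ℚ) 3 σ).val ^ (a - 1) ∧ ∃ c : «λ».adicCompletion E, ∀ i j : Fin 5, i ≠ 0 → i ≠ 4 → j ≠ 0 → j ≠ 4 → (Q⁻¹ * 𝓢.rep «λ» σ * Q).val i j = if i = j then c else 0) ∧ (∀ᶠ v : HeightOneSpectrum (𝓞 (CyclotomicField 3 ℚ)) in cofinite, ∃ P₀ : Polynomial (𝓞 E), P₀.map (algebraMap (𝓞 E) E) = 𝓢.charpoly v ∧ ∀ 𝔓 ∈ v.primesAbove, ∀ σ :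 absoluteGaloisGroup (CyclotomicField 3 ℚ), IsArithFrobAt (𝓞 (CyclotomicField 3 ℚ)) σ 𝔓 → (ρK σ).val.charpoly.map j = P₀.map (Ideal.Quotient.mk «λ».asIdeal))) → (∃ a : ℤ, ∀ σ : (CyclotomicField 3 ℚ) ≃ₐ[ℚ] (CyclotomicField 3 ℚ), σ ≠ AlgEquiv.refl → ∀ v w : HeightOneSpectrum (𝓞 (CyclotomicField 3 ℚ)), v ∉ 𝓢.bad → w ∉ 𝓢.bad → w.asIdeal = Ideal.comap (RingOfIntegers.mapRingHom σ.toRingEquiv.toRingHom) v.asIdeal → 𝓢.charpoly w = C ((𝓢.charpoly v).coeff 0)⁻¹ * ((𝓢.charpoly v).comp (C ((v.residueCard : E) ^ a) * X)).reverse) → ∀ (emb : E →+* ℂ) (hcpt : isCompact_glFiniteIntegralLevel 5 (CyclotomicField 3 ℚ)), ∃ π : CuspidalAutomorphicRepData 5 (CyclotomicField 3 ℚ) hcpt, π.1.IsLAlgebraic ∧ ∀ᶠ v : HeightOneSpectrum (𝓞 (CyclotomicField 3 ℚ)) in cofinite, ∃ α : Multiset ℂ, π.1.HasSatakeParamAt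 v α ∧ (𝓢.charpoly v).map emb = (α.map fun a ↦ X - C a⁻¹).prod

/-- item stmt-Langlands-14224 · support · rank 4 · open · by planner
why it might fail: As typed it cannot: the ∃ is inhabited by genus-2 3-torsion — certified witness C: y²+x³y = 2368x⁴+1458x³+2368x²−729x−1276 (Jac(C)[3] ↠ GSp₄(𝔽₃), #C(𝔽₂)=3 so Frob₂ ∉ 4C/12C, split ordinary at 3) transported through PGSp₄(𝔽₃)≅SO₅(𝔽₃); only the cubic-surface witness (item 14877) is in doubt.
sources: arXiv:2502.20645, BCGP2025ModularityAbelianSurfaces, ElsenhansJahnel2011, Hunt1996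
[crux] NON-VACUITY OF THE TRANSPORT CLASS (new, typed part of card D1(c)/the retired informal crux):
there EXISTS a continuous ρ̄ : Γ_ℚ → SO₅(𝔽₃) with all seven hypotheses of E6ResidualTransport
(surjective; spinor parity = ε̄; tr ρ̄(c) = 1; unramified at 2 with Frobenius polynomial ≠
(X−1)³(X²+1); inertia at 3 = {1,t}, t² = 1, tr t = 1, non-trivial; a continuous GSp₄(𝔽₃)-valued ρ̃
with ρ̃⁻¹(centre) = ker ρ̄). Intended witness: ρ̄ = det(ρ̄₂₇)·ρ̄₂₇ for the 27 lines of a smooth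
cubic surface S/ℚ with Gal(ℚ(lines)/ℚ) = W(E₆), Δ(S) ∈ ℚ^{×2} (ElsenhansJahnel2011 Thm 2.12: the
quadratic subfield of ℚ(lines) is ℚ(√(−3Δ)), so parity = ε̄ iff Δ is a square; this FORCES bad
reduction at 3), exactly 3 real lines (c of type A₁³), good reduction at 2 off the excluded
Frobenius class, and reduction at 3 with three conjugate nodes of odd depth (tame inertia acting
through one A₁³ involution) and vanishing local lifting obstructions at every bad prime (lifts of
two commuting twisted reflections generate Q₈, so e.g. a prime with two Frobenius-conjugate nodes is
forbidden); any W(E₆)-polynomial with these local types also proves it. Refutable by a global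
incompatibility of the prescribed local types -/
@[route_item "route-Langlands-OccultE6Transport"]
def E6TypeRealised : Prop :=
  open Literature.NumberTheory.GaloisRepresentations Literature.NumberTheory.Automorphic Polynomial NumberField IsDedekindDomain Field in ∃ ρ : FramedGaloisRep ℚ (ZMod 3) 5, (∀ σ, (ρ σ).valᵀ * (ρ σ).val = 1 ∧ (ρ σ).val.det = 1) ∧ (∀ g : Matrix (Fin 5) (Fin 5) (ZMod 3), gᵀ * g = 1 → g.det = 1 → ∃ σ, (ρ σ).val = g) ∧ (∀ (σ : absoluteGaloisGroup ℚ) (ζ : AlgebraicClosure ℚ), ζ ^ 2 + ζ + 1 = 0 → (σ • ζ = ζ ↔ ρ σ ∈ Subgroup.closure ((fun x : GL (Fin 5) (ZMod 3) ↦ x * x) '' {x : GL (Fin 5) (ZMod 3) | x.valᵀ * x.val = 1}))) ∧ (∀ (φ : ℚ →+* ℝ) (c : absoluteGaloisGroup ℚ), IsComplexConjugation φ c → (ρ c).val.trace = 1) ∧ (∀ v : HeightOneSpectrum (𝓞 ℚ), (2 : 𝓞 ℚ) ∈ v.asIdeal → ρ.IsUnramifiedAt v ∧ ∀ P, ρ.HasFrobCharpolyAt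 v P → P ≠ (X - 1) ^ 3 * (X ^ 2 + 1)) ∧ (∀ v : HeightOneSpectrum (𝓞 ℚ), (3 : 𝓞 ℚ) ∈ v.asIdeal → ∀ 𝔓 ∈ v.primesAbove, ∃ t : Matrix (Fin 5) (Fin 5) (ZMod 3), t * t = 1 ∧ t.trace = 1 ∧ (∀ σ ∈ 𝔓.inertia (absoluteGaloisGroup ℚ), (ρ σ).val = 1 ∨ (ρ σ).val = t) ∧ (∃ σ ∈ 𝔓.inertia (absoluteGaloisGroup ℚ), (ρ σ).val = t)) ∧ (∃ ρt : FramedGaloisRep ℚ (ZMod 3) 4, (∀ σ, (∃ ν : ZMod 3, ν ≠ 0 ∧ (ρt σ).valᵀ * !![0, 0, 1, 0; 0, 0, 0, 1; -1, 0, 0, 0; 0, -1, 0, 0] * (ρt σ).val = ν • !![0, 0, 1, 0; 0, 0, 0, 1; -1, 0, 0, 0; 0, -1, 0, 0])) ∧ ∀ σ, (ρ σ = 1 ↔ ∃ c : ZMod 3, (ρt σ).val = c • (1 : Matrix (Fin 4) (Fin 4) (ZMod 3))))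

-- item stmt-Langlands-14877 · support · rank 5 · open · by planner — informal only, no Lean statement yet:
--   [crux] OCCULT SYSTEMS OF CUBIC SURFACES ARE OF E6 TYPE (the cubic-surface content; informal until
--   the definition items CubicSurface / CubicSurface.linesOrthogonalRep / CubicSurface.occultSystem
--   land). (1) SYSTEM: for every smooth cubic surface S/Q with T_S : w^3 = F(x) the cyclic cubic
--   threefold, the omega-eigenspaces of H^3_et(T_S) (twist) form a rank-5 weakly compatible system S_S
--   over K = Q(omega) with coefficients K (AllcockCarlsonToledo2002: H^3(T_S,Z) is a Z[omega]-lattice of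
--   rank 5, signature (4,1); Achter2020: Galois-equivariance; Deligne purity), POLARISED with a = 3
--   (Poincare duality

/-- item stmt-Langlands-14225 · support · rank 9 · open · by planner
sources: BuzzardGeeLMS2014, FontaineMazurGeometric1995
[support] OUT-OF-SCOPE REMAINDER = the rest of the summit: `OccultTypeAutomorphy → Langlands`. NOT
attacked by this route and not expected to close before the summit itself; filed only so that the
deciding theorem `closes : E6ResidualTransport → PolarisedLiftingRank5 → SectorComplement →
_root_.Langlands` honestly concludes the summit constant (D-0027 §2.1; same convention as
E8QuinticResidue.SectorComplement, GaloisWeightedBE.SectorComplement,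
CapacityClassicality.SectorToLanglands: the summit shape `∀ F ∃ 𝓡 ∀ n, (A) ∧ (B)` cannot follow from
one sector). It contains everything this thesis does not claim: direction (A), every (n, F) ≠ (5,
ℚ(ω)), every ρ outside the occult class, local–global compatibility at every finite place and the
reciprocity data 𝓡 even inside the sector. Trivially implied by `Langlands`. Refuters/graders: judge
the route on E6ResidualTransport / PolarisedLiftingRank5 / E6TypeRealised, never on this item; never
staffed from this route. [difficulty: open-problem] -/
@[route_item "route-Langlands-OccultE6Transport", crux]
def SectorComplement : Prop :=
  OccultTypeAutomorphy → _root_.Langlands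

/-- item stmt-Langlands-14226 · support · rank 9 · open · by planner
sources: Hunt1996, Dolgachev2012, AllcockCarlsonToledo2002
[support] Dictionary, first half (finite, kernel-checkable): the Coxeter group of type E₆ (Mathlib
`CoxeterMatrix.E₆.Group`, |W| = 51840) is isomorphic to SO₅(𝔽₃) = {g ∈ GL₅(𝔽₃) | gᵀg = 1, det g =
1}, via w ↦ det(w)·w on (E₆/3E₆)/radical = Λ_S/(1−ω)Λ_S [AllcockCarlsonToledo2002; Bourbaki Lie VI
§4 Ex. 2; ATLAS U₄(2) ≅ S₄(3) ≅ O₅(3); Hunt1996 Ch. 5–6; Dolgachev2012 Ch. 9]. Route to a proof: six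
elements det(r)·r, r the reflections of an E₆ diagram of norm-(−1) vectors, braid relations via
PresentedGroup.toGroup, injectivity from simplicity of W(E₆)′ plus an order count (decide/native
computation only within the gate's axiom whitelist). [difficulty: provable-now] -/
@[route_item "route-Langlands-OccultE6Transport"]
def WeylE6IsoSO5F3 : Prop :=
  ∃ f : CoxeterMatrix.E₆.Group →* GL (Fin 5) (ZMod 3), Function.Injective f ∧ Set.range (fun w ↦ (f w).val) = {g : Matrix (Fin 5) (Fin 5) (ZMod 3) | gᵀ * g = 1 ∧ g.det = 1}

/-- item stmt-Langlands-14227 · support · rank 9 · open · by planner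
sources: Hunt1996, Dolgachev2012
[support] Dictionary, second half (exceptional isogeny B₂ = C₂ realised by ∧²₀ in characteristic 3):
a homomorphism Sp₄(𝔽₃) (Mathlib `Matrix.symplecticGroup (Fin 2) (ZMod 3)`) → GL₅(𝔽₃) with kernel
{±1} and image Ω₅(𝔽₃) = ⟨squares of SO₅(𝔽₃)⟩ (index 2, ≅ PSp₄(𝔽₃) ≅ W(E₆)′, simple of order 25920).
Construction: g ↦ ∧²g on ω^⊥ ⊂ ∧²(𝔽₃⁴) = ⟨ω⟩ ⊥ (5-dim), non-degenerate because ω∧ω ≠ 0 (2 ≠ 0 in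
𝔽₃); the similitude version PGSp₄(𝔽₃) ≅ SO₅(𝔽₃) is 'ν = spinor norm', the identity that forces the
similitude of every lift in E6ResidualTransport; completeness Aut SO₅(𝔽₃) = Inn turns the kernel
form of clause (vii) into an honest lift [Hunt1996, Dolgachev2012]. [difficulty: provable-now] -/
@[route_item "route-Langlands-OccultE6Transport"]
def Sp4F3OntoOmega5 : Prop :=
  ∃ f : Matrix.symplecticGroup (Fin 2) (ZMod 3) →* GL (Fin 5) (ZMod 3), (∀ x, f x = 1 ↔ ((x : Matrix (Fin 2 ⊕ Fin 2) (Fin 2 ⊕ Fin 2) (ZMod 3)) = 1 ∨ (x : Matrix (Fin 2 ⊕ Fin 2) (Fin 2 ⊕ Fin 2) (ZMod 3)) = -1)) ∧ Set.range (fun x ↦ (f x).val) = (fun y : GL (Fin 5) (ZMod 3) ↦ y.val) '' (Subgroup.closure ((fun x : GL (Fin 5) (ZMod 3) ↦ x * x) '' {x : GL (Fin 5) (ZMod 3) | x.valᵀ * x.val = 1 ∧ x.val.det = 1}) : Set (GL (Fin 5) (ZMod 3)))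

/-- item stmt-Langlands-14228 · assembly · rank 1 · open · by planner
sources: BCGP2025ModularityAbelianSurfaces, AllcockCarlsonToledo2002
[assembly] E6ResidualTransport → PolarisedLiftingRank5 → OccultTypeAutomorphy (pure glue, proved in
Sketch.lean as `assembly_holds`). -/
@[route_item "route-Langlands-OccultE6Transport"]
def Assembly : Prop :=
  E6ResidualTransport → PolarisedLiftingRank5 → OccultTypeAutomorphy

/-! D-0027 §2.1 — DECIDING THEOREM (planner-authored via `route open/edit --closes-file`; by planner-plancard-Langlands-Langlands-cubic-su-8ab83e6d-g2-0 2026-08-15T19:06:45Z):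
its hypotheses are this route's items and its conclusion the sub-problem Statement (glue_lint), and it elaborates with this file. -/

@[closes "route-Langlands-OccultE6Transport"] theorem closes (hA : E6ResidualTransport) (hB : PolarisedLiftingRank5) (hC : SectorComplement) : _root_.Langlands := by
  refine hC ?_
  intro E _ _ 𝓢 hyp hPol emb hcpt
  obtain ⟨«λ», j, ρ, hO, hS, hP, hc, h2, h3, hL, hComm, hIrr, hOrd, hRed⟩ := hyp
  refine hB E 𝓢 ⟨«λ», j, ρ.restrictField (CyclotomicField 3 ℚ), ?_, hComm, ?_, hIrr, hOrd, hRed⟩ hPol emb hcpt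
  · intro σ
    exact hO _
  · exact hA ρ ⟨hO, hS, hP, hc, h2, h3, hL⟩

end Summit.Langlands.Langlands.Theses.OccultE6Transport
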